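import Summits.HodgeConjecture.HodgeConjecture.Theorems.ELineTransportELineConnectivityRForm

/-!
# Route `ELineTransport` — support item `ELineConnectivityR` (stmt-HodgeConjecture-13981), part 5:
# generic parameters for the chain (Baire category)

For the chain `W₀, ⟨F b₁, s, n⟩, ⟨F b₁, F b₂, n⟩, W₁` of the proof of
`Theses.ELineTransport.ELineConnectivityR` (`s = (b₁.b₁) b₂ - (b₂.b₁) b₁`, `F = π` the transfer map
`W₀ → W₁`) the two WITNESS VECTORS `s ∈ ⟨s, n⟩` and `F b₁ ∈ ⟨F b₁, n⟩ ∩ ⟨F b₁, F b₂⟩` must avoid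
countably many closed nowhere dense conditions: orthogonality to a non-zero rational vector `l`
(NS-badness) and membership in one of countably many planes `Q i` (End-badness, the CM planes).
`exists_generic_pair` produces such `b₁, b₂ ∈ W₀` by the Baire category theorem on
`ℝ²² × ℝ²²` (parameters pulled back to `W₀` along a linear projection), the emptiness of interiors
resting on two covering lemmas for the positive definite `3`-plane `W₀`:

* `le_of_ball` — a subspace containing a `W₀`-ball contains `W₀`;
* `le_of_perp_planes` — a subspace containing the planes `b^⊥ ∩ W₀` for all `b ≠ 0` of a `W₀`-ball
  contains `W₀`.

Genericity of `W₀` and `W₁` (`W_i^⊥ ∩ ℚ²² = 0`) is exactly what makes the NS-conditions nowhere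
dense; `dim Q i ≤ 2 < 3` does it for the End-conditions. No definitions, no named facts, no sorry.
-/

-- `Summit.HodgeConjecture.HodgeConjecture.…` (summit = problem) duplicates a namespace component by design (D-0017).
set_option linter.dupNamespace false

noncomputable section

open Matrix Module Topology

namespace Summit.HodgeConjecture.HodgeConjecture.Theorems

namespace ELineConnR

local notation3 "BR" => (Matrix.toBilin' (Matrix.diagonal
  (fun i : Fin 22 => if i.val < 3 then (1 : ℝ) else -1)) : LinearMap.BilinForm ℝ (Fin 22 → ℝ))

/-! ### Continuity of the form -/

/-- The real form is jointly continuous (along continuous maps). [folklore] -/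
theorem continuous_form₂ {X : Type*} [TopologicalSpace X] {f g : X → (Fin 22 → ℝ)}
    (hf : Continuous f) (hg : Continuous g) : Continuous fun x => BR (f x) (g x) := by
  have h : (fun x => BR (f x) (g x)) =
      fun x => ∑ i, (if i.val < 3 then (1 : ℝ) else -1) * f x i * g x i := by
    funext x; rw [form_apply]
  rw [h]
  refine continuous_finsetSum _ fun i _ => ?_
  exact ((continuous_const.mul ((continuous_apply i).comp hf)).mul ((continuous_apply i).comp hg))

/-! ### Covering lemmas for a positive definite plane -/

/-- **A subspace containing a `W₀`-ball contains `W₀`.** [folklore] -/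
theorem le_of_ball {W₀ S : Submodule ℝ (Fin 22 → ℝ)} {β : Fin 22 → ℝ} (hβ : β ∈ W₀) {r : ℝ}
    (hr : 0 < r) (h : ∀ b ∈ W₀, ‖b - β‖ < r → b ∈ S) : W₀ ≤ S := by
  intro w hw
  have hβS : β ∈ S := h β hβ (by simp [hr])
  set t : ℝ := r / (2 * (‖w‖ + 1)) with ht
  have hw1 : 0 < ‖w‖ + 1 := by positivity
  have ht0 : 0 < t := by positivity
  have hnorm : ‖(β + t • w) - β‖ < r := by
    rw [add_sub_cancel_left, norm_smul, Real.norm_of_nonneg ht0.le, ht]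
    calc r / (2 * (‖w‖ + 1)) * ‖w‖ ≤ r / (2 * (‖w‖ + 1)) * (‖w‖ + 1) := by
          gcongr; linarith
      _ = r / 2 := by field_simp
      _ < r := by linarith
  have hmem := h (β + t • w) (W₀.add_mem hβ (W₀.smul_mem t hw)) hnorm
  have htw : t • w ∈ S := by simpa using S.sub_mem hmem hβS
  exact (S.smul_mem_iff ht0.ne').1 htw

/-- In a `3`-plane there is a non-zero vector orthogonal to any given vector. [folklore] -/
theorem exists_perp_mem {W₀ : Submodule ℝ (Fin 22 → ℝ)} (hW₀3 : finrank ℝ W₀ = 3)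
    (w : Fin 22 → ℝ) : ∃ u ∈ W₀, u ≠ 0 ∧ BR w u = 0 := by
  set φ : W₀ →ₗ[ℝ] ℝ := (BR w).comp W₀.subtype with hφ
  have h := LinearMap.finrank_range_add_finrank_ker φ
  have hr : finrank ℝ (LinearMap.range φ) ≤ 1 :=
    (Submodule.finrank_le _).trans (by simp)
  rw [hW₀3] at h
  have hk : 0 < finrank ℝ (LinearMap.ker φ) := by omega
  obtain ⟨⟨⟨u, huW⟩, hker⟩, hne⟩ :=
    (Module.finrank_pos_iff_exists_ne_zero (R := ℝ) (M := LinearMap.ker φ)).1 hk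
  refine ⟨u, huW, fun h0 => hne (Subtype.ext (Subtype.ext h0)), ?_⟩
  have := LinearMap.mem_ker.1 hker
  simpa [hφ] using this

/-- **A subspace containing the planes `b^⊥ ∩ W₀` for all non-zero `b` in a `W₀`-ball contains
`W₀`** (`W₀` a positive definite `3`-plane). [folklore] -/
theorem le_of_perp_planes {W₀ S : Submodule ℝ (Fin 22 → ℝ)} (hW₀3 : finrank ℝ W₀ = 3)
    (hW₀pos : ∀ u ∈ W₀, u ≠ 0 → 0 < BR u u) {β : Fin 22 → ℝ} (hβ : β ∈ W₀) {r : ℝ} (hr : 0 < r)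
    (h : ∀ b ∈ W₀, ‖b - β‖ < r → b ≠ 0 → ∀ u ∈ W₀, BR u b = 0 → u ∈ S) : W₀ ≤ S := by
  by_cases hβ0 : β = 0
  · -- small non-zero vectors orthogonal to `w`
    intro w hw
    obtain ⟨u₀, hu₀W, hu₀0, hwu₀⟩ := exists_perp_mem hW₀3 w
    set t : ℝ := r / (2 * (‖u₀‖ + 1)) with ht
    have ht0 : 0 < t := by positivity
    have hnorm : ‖t • u₀ - β‖ < r := by
      rw [hβ0, sub_zero, norm_smul, Real.norm_of_nonneg ht0.le, ht]
      calc r / (2 * (‖u₀‖ + 1)) * ‖u₀‖ ≤ r / (2 * (‖u₀‖ + 1)) * (‖u₀‖ + 1) := by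
            gcongr; linarith
        _ = r / 2 := by field_simp
        _ < r := by linarith
    refine h (t • u₀) (W₀.smul_mem t hu₀W) hnorm (smul_ne_zero ht0.ne' hu₀0) w hw ?_
    rw [LinearMap.BilinForm.smul_right, hwu₀, mul_zero]
  · -- `β ≠ 0`: first `β^⊥ ∩ W₀ ≤ S`, then `β ∈ S`
    have hperp : ∀ u ∈ W₀, BR u β = 0 → u ∈ S := fun u hu hub =>
      h β hβ (by simp [hr]) hβ0 u hu hub
    have hββ : 0 < BR β β := hW₀pos β hβ hβ0
    obtain ⟨u₀, hu₀W, hu₀0, hβu₀⟩ := exists_perp_mem hW₀3 β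
    have hu₀β : BR u₀ β = 0 := by rw [form_comm]; exact hβu₀
    have hu₀u₀ : 0 < BR u₀ u₀ := hW₀pos u₀ hu₀W hu₀0
    set ε : ℝ := r / (2 * (‖u₀‖ + 1)) with hε
    have hε0 : 0 < ε := by positivity
    set b : Fin 22 → ℝ := β + ε • u₀ with hb
    have hbW : b ∈ W₀ := W₀.add_mem hβ (W₀.smul_mem ε hu₀W)
    have hnorm : ‖b - β‖ < r := by
      rw [hb, add_sub_cancel_left, norm_smul, Real.norm_of_nonneg hε0.le, hε]
      calc r / (2 * (‖u₀‖ + 1)) * ‖u₀‖ ≤ r / (2 * (‖u₀‖ + 1)) * (‖u₀‖ + 1) := by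
            gcongr; linarith
        _ = r / 2 := by field_simp
        _ < r := by linarith
    have hb0 : b ≠ 0 := by
      intro hb0
      have h1 : BR β b = 0 := by rw [hb0, LinearMap.BilinForm.zero_right]
      rw [hb, LinearMap.BilinForm.add_right, LinearMap.BilinForm.smul_right, hβu₀, mul_zero,
        add_zero] at h1
      exact hββ.ne' h1
    -- the vector `v = (ε (u₀.u₀)) β - (β.β) u₀` is orthogonal to `b`
    set v : Fin 22 → ℝ := (ε * BR u₀ u₀) • β - BR β β • u₀ with hv
    have hvW : v ∈ W₀ := W₀.sub_mem (W₀.smul_mem _ hβ) (W₀.smul_mem _ hu₀W)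
    have hvb : BR v b = 0 := by
      rw [hv, hb, LinearMap.BilinForm.sub_left, LinearMap.BilinForm.smul_left,
        LinearMap.BilinForm.smul_left, LinearMap.BilinForm.add_right,
        LinearMap.BilinForm.add_right, LinearMap.BilinForm.smul_right,
        LinearMap.BilinForm.smul_right, hβu₀, hu₀β]
      ring
    have hvS : v ∈ S := h b hbW hnorm hb0 v hvW hvb
    have hu₀S : u₀ ∈ S := hperp u₀ hu₀W hu₀β
    have hβS : β ∈ S := by
      have h1 : (ε * BR u₀ u₀) • β = v + BR β β • u₀ := by rw [hv]; abel
      have h2 : (ε * BR u₀ u₀) • β ∈ S := by rw [h1]; exact S.add_mem hvS (S.smul_mem _ hu₀S)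
      exact (S.smul_mem_iff (mul_pos hε0 hu₀u₀).ne').1 h2
    -- any `w ∈ W₀` splits along `β` and `β^⊥`
    intro w hw
    have hsplit : w = (w - (BR w β / BR β β) • β) + (BR w β / BR β β) • β := by abel
    rw [hsplit]
    refine S.add_mem (hperp _ (W₀.sub_mem hw (W₀.smul_mem _ hβ)) ?_) (S.smul_mem _ hβS)
    rw [LinearMap.BilinForm.sub_left, LinearMap.BilinForm.smul_left, div_mul_cancel₀ _ hββ.ne',
      sub_self]

/-! ### Generic parameters -/

/-- **Generic parameters for the chain** (Baire category). Let `W₀, W₁ ⊂ ℝ²²` be `3`-planes,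
`W₀` positive definite, both GENERIC (`W_i^⊥ ∩ ℚ²² = 0`), `π` a linear map of `ℝ²²` mapping
`W₀` onto `W₁`, and `(Q_i)` a countable family of subspaces of dimension `≤ 2`. Then there
are `b₁, b₂ ∈ W₀` with `s := (b₁.b₁) b₂ - (b₂.b₁) b₁ ≠ 0` such that neither `s` nor `π b₁` is
orthogonal to a non-zero rational vector or lies in some `Q_i`. [folklore] -/
theorem exists_generic_pair (W₀ W₁ : Submodule ℝ (Fin 22 → ℝ)) (hW₀3 : finrank ℝ W₀ = 3)
    (hW₀pos : ∀ u ∈ W₀, u ≠ 0 → 0 < BR u u) (hW₁3 : finrank ℝ W₁ = 3)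
    (hg₀ : ∀ l : Fin 22 → ℚ, (∀ u ∈ W₀, BR (fun j => ((l j : ℚ) : ℝ)) u = 0) → l = 0)
    (hg₁ : ∀ l : Fin 22 → ℚ, (∀ u ∈ W₁, BR (fun j => ((l j : ℚ) : ℝ)) u = 0) → l = 0)
    (π : (Fin 22 → ℝ) →ₗ[ℝ] (Fin 22 → ℝ)) (hπs : ∀ y ∈ W₁, ∃ w ∈ W₀, π w = y)
    {ι : Type} [Countable ι] (Q : ι → Submodule ℝ (Fin 22 → ℝ)) (hQ : ∀ i, finrank ℝ (Q i) ≤ 2) :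
    ∃ b₁ ∈ W₀, ∃ b₂ ∈ W₀,
      BR b₁ b₁ • b₂ - BR b₂ b₁ • b₁ ≠ 0 ∧
      (∀ l : Fin 22 → ℚ, l ≠ 0 →
        BR (fun j => ((l j : ℚ) : ℝ)) (BR b₁ b₁ • b₂ - BR b₂ b₁ • b₁) ≠ 0) ∧
      (∀ l : Fin 22 → ℚ, l ≠ 0 → BR (fun j => ((l j : ℚ) : ℝ)) (π b₁) ≠ 0) ∧
      (∀ i, BR b₁ b₁ • b₂ - BR b₂ b₁ • b₁ ∉ Q i) ∧ (∀ i, π b₁ ∉ Q i) := by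
  classical
  -- a linear projection `P₀` of `ℝ²²` onto `W₀`
  obtain ⟨g, hg⟩ := W₀.subtype.exists_leftInverse_of_injective (Submodule.ker_subtype W₀)
  set P₀ : (Fin 22 → ℝ) →ₗ[ℝ] (Fin 22 → ℝ) := W₀.subtype.comp g with hP₀
  have hP₀W : ∀ v, P₀ v ∈ W₀ := fun v => by simp [hP₀]
  have hP₀id : ∀ w ∈ W₀, P₀ w = w := by
    intro w hw
    have := LinearMap.congr_fun hg ⟨w, hw⟩
    simpa [hP₀] using congrArg Subtype.val this
  -- the witness map and its continuity
  set sV : (Fin 22 → ℝ) → (Fin 22 → ℝ) → (Fin 22 → ℝ) :=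
    fun b₁ b₂ => BR b₁ b₁ • b₂ - BR b₂ b₁ • b₁ with hsV
  have hP₀c : Continuous P₀ := P₀.continuous_of_finiteDimensional
  have hπc : Continuous π := π.continuous_of_finiteDimensional
  have hc1 : Continuous fun c : (Fin 22 → ℝ) × (Fin 22 → ℝ) => P₀ c.1 := hP₀c.comp continuous_fst
  have hc2 : Continuous fun c : (Fin 22 → ℝ) × (Fin 22 → ℝ) => P₀ c.2 := hP₀c.comp continuous_snd
  have hsc : Continuous fun c : (Fin 22 → ℝ) × (Fin 22 → ℝ) => sV (P₀ c.1) (P₀ c.2) := by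
    have h11 : Continuous fun c : (Fin 22 → ℝ) × (Fin 22 → ℝ) => BR (P₀ c.1) (P₀ c.1) :=
      continuous_form₂ hc1 hc1
    have h21 : Continuous fun c : (Fin 22 → ℝ) × (Fin 22 → ℝ) => BR (P₀ c.2) (P₀ c.1) :=
      continuous_form₂ hc2 hc1
    simp only [hsV]
    exact (h11.smul hc2).sub (h21.smul hc1)
  have hFc : Continuous fun c : (Fin 22 → ℝ) × (Fin 22 → ℝ) => π (P₀ c.1) := hπc.comp hc1
  have hlc : ∀ l : Fin 22 → ℝ, Continuous fun v : Fin 22 → ℝ => BR l v := fun l =>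
    continuous_form₂ continuous_const continuous_id
  -- transfer of a ball in the parameter space to `W₀`-balls
  have htrans : ∀ {s : Set ((Fin 22 → ℝ) × (Fin 22 → ℝ))} {c : (Fin 22 → ℝ) × (Fin 22 → ℝ)}
      {r : ℝ}, Metric.ball c r ⊆ s → ∀ b₁ ∈ W₀, ∀ b₂ ∈ W₀, ‖b₁ - P₀ c.1‖ < r →
        ‖b₂ - P₀ c.2‖ < r → ∃ c' ∈ s, P₀ c'.1 = b₁ ∧ P₀ c'.2 = b₂ := by
    intro s c r hs b₁ hb₁ b₂ hb₂ h1 h2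
    refine ⟨(c.1 + (b₁ - P₀ c.1), c.2 + (b₂ - P₀ c.2)), hs ?_, ?_, ?_⟩
    · rw [Metric.mem_ball, Prod.dist_eq, dist_eq_norm, dist_eq_norm, add_sub_cancel_left,
        add_sub_cancel_left]
      exact max_lt h1 h2
    · simp only [map_add, hP₀id _ (W₀.sub_mem hb₁ (hP₀W _)), add_sub_cancel]
    · simp only [map_add, hP₀id _ (W₀.sub_mem hb₂ (hP₀W _)), add_sub_cancel]
  -- the four families of bad sets, indexed by one countable type
  set L := {l : Fin 22 → ℚ // l ≠ 0} with hL
  set bad : (L ⊕ ι) ⊕ (L ⊕ ι) → Set ((Fin 22 → ℝ) × (Fin 22 → ℝ)) :=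
    Sum.elim
      (Sum.elim (fun l => {c | BR (fun j => ((l.1 j : ℚ) : ℝ)) (sV (P₀ c.1) (P₀ c.2)) = 0})
        (fun i => {c | sV (P₀ c.1) (P₀ c.2) ∈ Q i}))
      (Sum.elim (fun l => {c | BR (fun j => ((l.1 j : ℚ) : ℝ)) (π (P₀ c.1)) = 0})
        (fun i => {c | π (P₀ c.1) ∈ Q i})) with hbad
  have hclosed : ∀ k, IsClosed (bad k) := by
    rintro ((l | i) | (l | i))
    · exact isClosed_eq ((hlc _).comp hsc) continuous_const
    · exact (Q i).closed_of_finiteDimensional.preimage hsc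
    · exact isClosed_eq ((hlc _).comp hFc) continuous_const
    · exact (Q i).closed_of_finiteDimensional.preimage hFc
  -- key algebra: from `s(b, b₂)` bad for a `W₀`-ball of `b₂`, badness of `b^⊥ ∩ W₀`
  have hsV_perp : ∀ b u : Fin 22 → ℝ, BR u b = 0 → sV b u = BR b b • u := by
    intro b u hub
    simp only [hsV]
    rw [hub, zero_smul, sub_zero]
  have hempty : ∀ k, interior (bad k) = ∅ := by
    intro k
    by_contra hne
    obtain ⟨c, hc⟩ := Set.nonempty_iff_ne_empty.2 hne
    obtain ⟨r, hr, hball⟩ := Metric.isOpen_iff.1 isOpen_interior c hc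
    have hsub : Metric.ball c r ⊆ bad k := hball.trans interior_subset
    have hβ₁ : P₀ c.1 ∈ W₀ := hP₀W _
    have hβ₂ : P₀ c.2 ∈ W₀ := hP₀W _
    rcases k with ((l | i) | (l | i))
    · -- NS-badness of `s`
      apply l.2
      apply hg₀
      suffices hW : W₀ ≤ LinearMap.ker (BR (fun j => ((l.1 j : ℚ) : ℝ))) from
        fun u hu => LinearMap.mem_ker.1 (hW hu)
      refine le_of_perp_planes hW₀3 hW₀pos hβ₁ hr ?_
      intro b hbW hbn hb0 u huW hub
      have hbb : 0 < BR b b := hW₀pos b hbW hb0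
      -- for all `b₂` near `P₀ c.2`: badness at `(b, b₂)`
      have hS : W₀ ≤ LinearMap.ker
          (BR b b • BR (fun j => ((l.1 j : ℚ) : ℝ)) - BR (fun j => ((l.1 j : ℚ) : ℝ)) b • BR b) := by
        refine le_of_ball hβ₂ hr ?_
        intro b₂ hb₂W hb₂n
        obtain ⟨c', hc', h1, h2⟩ := htrans hsub b hbW b₂ hb₂W hbn hb₂n
        have hc'' : BR (fun j => ((l.1 j : ℚ) : ℝ)) (sV (P₀ c'.1) (P₀ c'.2)) = 0 := hc'
        rw [h1, h2] at hc''
        simp only [hsV, LinearMap.BilinForm.sub_right, LinearMap.BilinForm.smul_right] at hc''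
        rw [LinearMap.mem_ker, LinearMap.sub_apply, LinearMap.smul_apply, LinearMap.smul_apply,
          smul_eq_mul, smul_eq_mul, form_comm b b₂]
        linarith
      have hu := LinearMap.mem_ker.1 (hS huW)
      rw [LinearMap.sub_apply, LinearMap.smul_apply, LinearMap.smul_apply, smul_eq_mul,
        smul_eq_mul, form_comm b u, hub, mul_zero, sub_zero] at hu
      rw [LinearMap.mem_ker]
      rcases mul_eq_zero.1 hu with h | h
      · exact absurd h hbb.ne'
      · exact h
    · -- End-badness of `s`
      have hW : W₀ ≤ Q i := by
        refine le_of_perp_planes hW₀3 hW₀pos hβ₁ hr ?_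
        intro b hbW hbn hb0 u huW hub
        have hbb : 0 < BR b b := hW₀pos b hbW hb0
        set T : (Fin 22 → ℝ) →ₗ[ℝ] (Fin 22 → ℝ) :=
          BR b b • LinearMap.id - (BR b).smulRight b with hT
        have hTs : ∀ v, T v = sV b v := by
          intro v
          simp only [hT, hsV, LinearMap.sub_apply, LinearMap.smul_apply, LinearMap.id_apply,
            LinearMap.smulRight_apply, form_comm b v]
        have hS : W₀ ≤ (Q i).comap T := by
          refine le_of_ball hβ₂ hr ?_
          intro b₂ hb₂W hb₂n
          obtain ⟨c', hc', h1, h2⟩ := htrans hsub b hbW b₂ hb₂W hbn hb₂n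
          have hc'' : sV (P₀ c'.1) (P₀ c'.2) ∈ Q i := hc'
          rw [h1, h2] at hc''
          rw [Submodule.mem_comap, hTs]
          exact hc''
        have hu := hS huW
        rw [Submodule.mem_comap, hTs, hsV_perp b u hub] at hu
        exact ((Q i).smul_mem_iff hbb.ne').1 hu
      have := Submodule.finrank_mono hW
      rw [hW₀3] at this
      exact absurd (this.trans (hQ i)) (by norm_num)
    · -- NS-badness of `π b₁`
      apply l.2
      apply hg₁
      have hW : W₀ ≤ LinearMap.ker ((BR (fun j => ((l.1 j : ℚ) : ℝ))).comp π) := by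
        refine le_of_ball hβ₁ hr ?_
        intro b hbW hbn
        obtain ⟨c', hc', h1, -⟩ := htrans hsub b hbW (P₀ c.2) hβ₂ hbn (by simp [hr])
        have hc'' : BR (fun j => ((l.1 j : ℚ) : ℝ)) (π (P₀ c'.1)) = 0 := hc'
        rw [h1] at hc''
        exact hc''
      intro y hy
      obtain ⟨w, hw, rfl⟩ := hπs y hy
      exact LinearMap.mem_ker.1 (hW hw)
    · -- End-badness of `π b₁`
      have hW : W₀ ≤ (Q i).comap π := by
        refine le_of_ball hβ₁ hr ?_
        intro b hbW hbn
        obtain ⟨c', hc', h1, -⟩ := htrans hsub b hbW (P₀ c.2) hβ₂ hbn (by simp [hr])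
        have hc'' : π (P₀ c'.1) ∈ Q i := hc'
        rw [h1] at hc''
        exact hc''
      have hW₁ : W₁ ≤ Q i := by
        intro y hy
        obtain ⟨w, hw, rfl⟩ := hπs y hy
        exact hW hw
      have := Submodule.finrank_mono hW₁
      rw [hW₁3] at this
      exact absurd (this.trans (hQ i)) (by norm_num)
  -- Baire
  have hdense : Dense (⋂ k, (bad k)ᶜ) :=
    dense_iInter_of_isOpen (fun k => (hclosed k).isOpen_compl)
      (fun k => interior_eq_empty_iff_dense_compl.1 (hempty k))
  -- the open set `s ≠ 0` is non-empty
  have hopen : IsOpen {c : (Fin 22 → ℝ) × (Fin 22 → ℝ) | sV (P₀ c.1) (P₀ c.2) ≠ 0} :=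
    isOpen_ne_fun hsc continuous_const
  have hne : {c : (Fin 22 → ℝ) × (Fin 22 → ℝ) | sV (P₀ c.1) (P₀ c.2) ≠ 0}.Nonempty := by
    have hpos : 0 < finrank ℝ W₀ := by rw [hW₀3]; norm_num
    obtain ⟨⟨b₁, hb₁W⟩, hb₁0⟩ := (Module.finrank_pos_iff_exists_ne_zero (R := ℝ)).1 hpos
    have hb₁0 : b₁ ≠ 0 := fun h => hb₁0 (Subtype.ext h)
    obtain ⟨u, huW, hu0, hbu⟩ := exists_perp_mem hW₀3 b₁
    refine ⟨(b₁, u), ?_⟩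
    have hub : BR u b₁ = 0 := by rw [form_comm]; exact hbu
    simp only [Set.mem_setOf_eq, hP₀id b₁ hb₁W, hP₀id u huW, hsV_perp b₁ u hub]
    exact smul_ne_zero (hW₀pos b₁ hb₁W hb₁0).ne' hu0
  obtain ⟨c, hcG, hcO⟩ := hdense.exists_mem_open hopen hne
  rw [Set.mem_iInter] at hcG
  refine ⟨P₀ c.1, hP₀W _, P₀ c.2, hP₀W _, hcO, ?_, ?_, ?_, ?_⟩
  · intro l hl
    exact hcG (Sum.inl (Sum.inl ⟨l, hl⟩))
  · intro l hl
    exact hcG (Sum.inr (Sum.inl ⟨l, hl⟩))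
  · intro i
    exact hcG (Sum.inl (Sum.inr i))
  · intro i
    exact hcG (Sum.inr (Sum.inr i))

end ELineConnR

end Summit.HodgeConjecture.HodgeConjecture.Theorems

end
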